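import Summits.QuantumFields.BalabanUV.Beta.TubeHolAlgebra

/-!
# Beta / TubeMinimumPrinciple — the pluriharmonic MINIMUM principle on the tube and a kernel route to (Z1) from face data
# (β sub-cell, BINDER-OWNERS row CAP-k, lineage `b2b-balaban-beta-an5`, gen 21; node BETA-an5-g21-FACE-MAXMOD part 5)

Companion to `Beta.TubeMaximumModulus` (p206863: `TubeHol.norm_le_of_vertexTori`) and `Beta.TubeHolAlgebra` (p207068).  The maximum
principle applied to `e^{−G}` (tube-holomorphic with `G`, §1): a lower bound `m ≤ Re G` on the VERTEX TORI propagates to the whole closed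
tube (`|e^{−G}| = e^{−Re G}`), §2.  Consequence, §3 — a SUFFICIENT kernel route to zero-freeness (the cell's (Z1), `det ≠ 0` on the period
cell) from FACE data: if `0 < m ≤ Re (F/g)` on the vertex tori for a reference multiplier `g` KNOWN to be zero-free on the period cell
(e.g. `g ≡ 1`, or the determinant of an explicitly invertible approximation), then `F` has no zero on the tube; matrix form
`MatTubeHol.det_ne_zero_of_re_div_pos_vertexTori` (the rows' `hdet` from a positive-real-part certificate of `det A / det A₀`).

HONEST FRAMING.  This is NOT the winding-number certificate of CAP-KERNEL §4.8 THEOREM DB (zero-free vertex tori + four windings = 0 ⟹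
zero-free polystrip), which needs the argument principle and stays OUTSIDE the kernel (census CAPK-CENSUS-g21 V18): it is the special case
in which a positive-real-part certificate relative to a known zero-free reference is available — whether the cell's `det k₀` admits such a
reference on the 0.9-strip is NOT claimed here (no number, no certificate, 0 binders instantiated).  Discharging `BetaPertH` would make
Bałaban's ultraviolet stability unconditional — NOT the continuum limit, NOT the Clay problem.  [folklore]; 0 `sorry`; 0 cite tags.
-/

namespace Summit.QuantumFields.BalabanUV.Beta.TubeMaximumModulus

open Complex Set
open Literature.MathematicalPhysics.QuantumFieldTheory.Balaban1983to89
open B4Strip (ofRealVec Strip)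
open Beta.AliasingTailL1
open scoped Real

noncomputable section

variable {d : ℕ}
variable {G : (Fin (d + 1) → ℂ) → ℂ} {w : Fin (d + 1) → ℝ}

/-! ## §1 Exponentials -/

/-- the exponential of a tube-holomorphic function is tube-holomorphic. [folklore] -/
theorem TubeHol.cexp (h : TubeHol G w) : TubeHol (fun p => Complex.exp (G p)) w := by
  refine ⟨?_, h.cont.cexp, fun i q hq => (h.diff i q hq).cexp⟩
  intro i p
  show _ = _
  rw [h.periodic i p]

/-! ## §2 The minimum ∕ maximum principle for the real part -/

/-- **THE MINIMUM PRINCIPLE FOR `Re G`**: `m ≤ Re G` on the vertex tori ⟹ `m ≤ Re G` on the whole closed tube (the face theorem for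
`e^{−G}`). [folklore] -/
theorem TubeHol.re_ge_of_vertexTori (h : TubeHol G w) {m : ℝ} (hm : ∀ p ∈ VertexTori w, m ≤ (G p).re) :
    ∀ p ∈ Tube w, m ≤ (G p).re := by
  intro p hp
  have key := h.neg.cexp.norm_le_of_vertexTori (M := Real.exp (-m)) (fun q hq => by
    rw [Complex.norm_exp, neg_re]
    exact Real.exp_le_exp.mpr (neg_le_neg (hm q hq))) p hp
  rw [Complex.norm_exp, neg_re, Real.exp_le_exp, neg_le_neg_iff] at key
  exact key

/-- the MAXIMUM principle for `Re G`: `Re G ≤ m` on the vertex tori ⟹ on the closed tube. [folklore] -/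
theorem TubeHol.re_le_of_vertexTori (h : TubeHol G w) {m : ℝ} (hm : ∀ p ∈ VertexTori w, (G p).re ≤ m) :
    ∀ p ∈ Tube w, (G p).re ≤ m := by
  intro p hp
  have key := h.neg.re_ge_of_vertexTori (m := -m) (fun q hq => by rw [neg_re]; exact neg_le_neg (hm q hq)) p hp
  rw [neg_re, neg_le_neg_iff] at key
  exact key

/-- the same two for the IMAGINARY part (apply the real-part principles to `−i·G`). [folklore] -/
theorem TubeHol.im_ge_of_vertexTori (h : TubeHol G w) {m : ℝ} (hm : ∀ p ∈ VertexTori w, m ≤ (G p).im) :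
    ∀ p ∈ Tube w, m ≤ (G p).im := by
  intro p hp
  have e : ∀ q, (-I * G q).re = (G q).im := fun q => by simp [neg_mul, neg_re]
  have key := (h.const_mul (-I)).re_ge_of_vertexTori (m := m) (fun q hq => by rw [e]; exact hm q hq) p hp
  rwa [e] at key

/-! ## §3 Zero-freeness from a positive-real-part certificate on the vertex tori -/

/-- **ZERO-FREENESS FROM A POSITIVE REAL PART ON THE VERTEX TORI**: `0 < m ≤ Re G` on the vertex tori ⟹ `G ≠ 0` on the closed tube. [folklore] -/
theorem TubeHol.ne_zero_of_re_pos_vertexTori (h : TubeHol G w) {m : ℝ} (hm0 : 0 < m)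
    (hm : ∀ p ∈ VertexTori w, m ≤ (G p).re) : ∀ p ∈ Tube w, G p ≠ 0 := by
  intro p hp hz
  have key := h.re_ge_of_vertexTori hm p hp
  rw [hz, Complex.zero_re] at key
  exact absurd key (not_le.mpr hm0)

/-- **ZERO-FREENESS RELATIVE TO A ZERO-FREE REFERENCE**: `F`, `g` tube-holomorphic, `g` with no zero on the period cell (KNOWN), and
`0 < m ≤ Re (F/g)` on the vertex tori ⟹ `F` has no zero on the closed tube. [folklore] -/
theorem TubeHol.ne_zero_of_re_div_pos_vertexTori {F g : (Fin (d + 1) → ℂ) → ℂ} (hF : TubeHol F w) (hg : TubeHol g w)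
    (hg0 : ∀ p ∈ PolyStrip w, g p ≠ 0) {m : ℝ} (hm0 : 0 < m)
    (hm : ∀ p ∈ VertexTori w, m ≤ (F p / g p).re) : ∀ p ∈ Tube w, F p ≠ 0 := by
  intro p hp hz
  have key := (hF.div hg hg0).ne_zero_of_re_pos_vertexTori hm0 hm p hp
  exact key (by simp only [hz, zero_div])

/-- the same read on the polystrip period cell (the shape of the rows' `hdet`). [folklore] -/
theorem TubeHol.ne_zero_polyStrip_of_re_div_pos_vertexTori {F g : (Fin (d + 1) → ℂ) → ℂ} (hF : TubeHol F w) (hg : TubeHol g w)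
    (hg0 : ∀ p ∈ PolyStrip w, g p ≠ 0) {m : ℝ} (hm0 : 0 < m)
    (hm : ∀ p ∈ VertexTori w, m ≤ (F p / g p).re) : ∀ p ∈ PolyStrip w, F p ≠ 0 :=
  fun p hp => hF.ne_zero_of_re_div_pos_vertexTori hg hg0 hm0 hm p (polyStrip_subset_tube w hp)

section Matrix

variable {n : Type*} [Fintype n] [DecidableEq n]
variable {A A₀ : (Fin (d + 1) → ℂ) → Matrix n n ℂ}

/-- **(Z1) FROM A POSITIVE-REAL-PART CERTIFICATE OF `det A / det A₀`**: `A`, `A₀` tube-holomorphic matrix families, `det A₀ ≠ 0` on the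
period cell KNOWN (the reference — e.g. an explicitly invertible approximation of `A`), and `0 < m ≤ Re (det A(q) / det A₀(q))` on the
vertex tori ⟹ `det A(q) ≠ 0` on the polystrip period cell = the rows' binder `hdet`. [folklore] -/
theorem MatTubeHol.det_ne_zero_of_re_div_pos_vertexTori (hA : MatTubeHol A w) (hA₀ : MatTubeHol A₀ w)
    (hdet₀ : ∀ p ∈ PolyStrip w, (A₀ p).det ≠ 0) {m : ℝ} (hm0 : 0 < m)
    (hm : ∀ p ∈ VertexTori w, m ≤ ((A p).det / (A₀ p).det).re) : ∀ p ∈ PolyStrip w, (A p).det ≠ 0 :=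
  hA.det.ne_zero_polyStrip_of_re_div_pos_vertexTori hA₀.det hdet₀ hm0 hm

/-- the absolute special case `A₀ = 1`: `0 < m ≤ Re det A(q)` on the vertex tori ⟹ (Z1). [folklore] -/
theorem MatTubeHol.det_ne_zero_of_re_pos_vertexTori (hA : MatTubeHol A w) {m : ℝ} (hm0 : 0 < m)
    (hm : ∀ p ∈ VertexTori w, m ≤ ((A p).det).re) : ∀ p ∈ PolyStrip w, (A p).det ≠ 0 :=
  fun p hp => hA.det.ne_zero_of_re_pos_vertexTori hm0 hm p (polyStrip_subset_tube w hp)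

end Matrix

end

end Summit.QuantumFields.BalabanUV.Beta.TubeMaximumModulus
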